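import Summits.ResolutionOfSingularities.ResolutionOfSingularities.Theorems.EquisingularLiftEquisingularLiftNatSpecimenWhitneyCubicForms
import Summits.ResolutionOfSingularities.ResolutionOfSingularities.Theorems.EquisingularLiftEquisingularLiftNatOneStep
import Summits.ResolutionOfSingularities.ResolutionOfSingularities.Theorems.EquisingularLiftEquisingularLiftLinearCentreLift
import Summits.ResolutionOfSingularities.ResolutionOfSingularities.Theorems.EquisingularLiftEquisingularLiftLinearCentreCharts
import Literature.AlgebraicGeometry.Resolution.AlterationsNormalFormBlowupFormalProofs
import Literature.AlgebraicGeometry.Resolution.ProjectiveSpaceRegular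
import Literature.AlgebraicGeometry.Resolution.IdealSheafLemmas
import Literature.AlgebraicGeometry.Limits.IdealSheafComap
import Literature.AlgebraicGeometry.Motives.ProjClosedFractions
import HarnessLib

/-!
# [OURS · L1 W4.5(b)] EL♮ specimen R2 — the WHITNEY-TYPE CUBIC: `Bl_Σ H` is regular, and EL♮ holds for `H`
# crux `Theses.EquisingularLift.EquisingularLiftNat` (stmt-ResolutionOfSingularities-20038), res-L1-w45b-plan-1 ORDERS (R2)

NOT a statement of any manuscript; OURS kernel specimen (cell `res-hironaka`, chain w45b, seat res-D-pv-022). AI-written,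
weaker than expert review.

`H = V₊(x₁x₂² − x₀x₃²) ⊂ ℙ³_k` (the tree's reduced hypersurface, `…WhitneyCubicForms`), `k` algebraically closed of
characteristic `p` (ANY `p`, `p = 2` included), double line `Σ = V(x₂, x₃) = V(Λ)` with `Λ = ker Proj(f_k)` the kill-map
linear centre (`r = 1`, `m = 2`; `StrataSplit.LinearCentre`). This file proves

* `isRegular_of_isBlowup_comap` — **every blow-up of `H` along `Λ · 𝒪_H` is a regular scheme**: over the chart `D₊(x_c)` the
  blow-up restricts to a blow-up of `Spec (ChartRing F c)` along `(x₂/x_c, x₃/x_c)~` (`IsBlowup.restrict`, the open immersion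
  `SmoothHypersurface.chart`, `Limits.ideal_comap_eq_map`, `LinearCentre.ker_projMap_kill_ideal_basicOpen`,
  `ProjFrac.appLE_awayι_eq_resAway`); for `c = 2, 3` the centre is the unit ideal (`x_c/x_c = 1`) and the chart ring is
  regular; for `c = 0, 1` the charts at the generators (`IsBlowup.exists_chart_of_span_range_eq`, Stacks 0804) are spectra of
  the regular rings of `…WhitneyCubicForms.isRegularRing_blowupAlgebra_tautVec`;
* `support_subset_range`, `not_range_subset_support` — `V(Λ) = V₊(x₂, x₃) ⊆ V₊(F) = ι(H)` and `ι(H) ⊄ V(Λ)` (the point `(F)`);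
* `elNatAt_whitneyCubic` — **EL♮ HOLDS FOR `H`**: `Theorems.EquisingularLift.ELNatAt p k 3 H ι` (p503491) by ONE horizontal
  E1 step, the blow-up of `ℙ³_{𝕎(k)}` along the `O`-line `V(x₂, x₃)` (`elNatAt_of_oneStep₀`, p505461; centre regular and
  `O`-flat and `C · 𝒪_{ℙ³_k} = Λ` exactly as in `LinearCentre.EL_of_linearCentre`, p479070).

Census value (ORDERS (R2)): the first kernel instance of EL♮ beyond isolated singularities (a CURVE singular locus, all `p`).
-/

set_option linter.dupNamespace false -- mandated namespace `Summit.<Summit>.<Problem>` of this single-conjunct summit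

noncomputable section

open CategoryTheory CategoryTheory.Limits AlgebraicGeometry TopologicalSpace
open MvPolynomial HomogeneousLocalization
open Literature.AlgebraicGeometry.Resolution
open Literature.AlgebraicGeometry.Motives Literature.AlgebraicGeometry.Motives.SmoothHypersurface
open Literature.AlgebraicGeometry.Motives.ProjectiveSpace
open AlgebraicGeometry.Scheme.IdealSheafData
open Summit.ResolutionOfSingularities.ResolutionOfSingularities.Cruxes.EquisingularLift.StrataSplit

namespace Summit.ResolutionOfSingularities.ResolutionOfSingularities.Cruxes.EquisingularLiftNat.Sections

namespace WhitneyCubic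

variable (k : Type) [Field k]

attribute [local instance] MvPolynomial.gradedAlgebra ProjBaseChange.algebraBase

/-! ## The kill-map centre `Λ = V₊(x₂, x₃)` and the hypersurface -/

section Kill

variable (fk : homogeneousSubmodule (Fin (1 + 2 + 1)) k →+*ᵍ homogeneousSubmodule (Fin (1 + 1)) k)
  (hfk' : HomogeneousIdeal.irrelevant (homogeneousSubmodule (Fin (1 + 1)) k) ≤
    (HomogeneousIdeal.irrelevant (homogeneousSubmodule (Fin (1 + 2 + 1)) k)).map fk) (hfkC : ∀ a : k, fk (C a) = C a)
  (hfkX : ∀ i : Fin (1 + 2 + 1), fk (X i) = if h : (i : ℕ) < 1 + 1 then X ⟨i, h⟩ else 0)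

include hfkC hfkX in
/-- Points of `V(Λ) = Proj(f_k)(ℙ¹_k)` lie in `V₊(x₂) ∩ V₊(x₃)`: `x_a` (`a ≥ 2`) belongs to their homogeneous prime
(`Proj.map_preimage_basicOpen`, `f_k(x_a) = 0`). [folklore] -/
theorem X_mem_of_mem_support {x : Proj (homogeneousSubmodule (Fin (1 + 2 + 1)) k)}
    (hx : x ∈ ((Proj.map fk hfk').ker.support : Set (Proj (homogeneousSubmodule (Fin (1 + 2 + 1)) k))))
    (a : Fin (1 + 2 + 1)) (ha : 1 + 1 ≤ (a : ℕ)) :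
    (X a : MvPolynomial (Fin (1 + 2 + 1)) k) ∈ x.asHomogeneousIdeal := by
  haveI : IsClosedImmersion (Proj.map fk hfk') :=
    Literature.AlgebraicGeometry.FundamentalGroup.isClosedImmersion_projMap_of_surjective fk hfk'
      (LinearCentre.kill_surjective fk.toRingHom (fun a => hfkC a) (fun i => hfkX i))
  have hsupp : ((Proj.map fk hfk').ker.support : Set (Proj (homogeneousSubmodule (Fin (1 + 2 + 1)) k))) =
      Set.range (Proj.map fk hfk') := by
    rw [Scheme.Hom.support_ker, (Proj.map fk hfk').isClosedEmbedding.isClosed_range.closure_eq]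
  rw [hsupp] at hx
  obtain ⟨y, rfl⟩ := hx
  by_contra hmem
  have hy : y ∈ Proj.map fk hfk' ⁻¹ᵁ Proj.basicOpen (homogeneousSubmodule (Fin (1 + 2 + 1)) k) (X a) :=
    (ProjectiveSpectrum.mem_basicOpen _ _ _).mpr hmem
  rw [Proj.map_preimage_basicOpen, hfkX a, dif_neg (by omega)] at hy
  exact (Proj.mem_basicOpen _ _ _).mp hy (Ideal.zero_mem _)

include hfkC hfkX in
/-- **`V(Λ) ⊆ V₊(F) = ι(H)`** (`F = x₁x₂² − x₀x₃² ∈ (x₂, x₃)`): the E1 clause at level `0`. [folklore] -/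
theorem support_subset_range :
    ((Proj.map fk hfk').ker.support : Set (Proj (homogeneousSubmodule (Fin (1 + 2 + 1)) k))) ⊆
      Set.range (hypersurfaceι (form k)).left := by
  intro x hx
  have h2 := X_mem_of_mem_support k fk hfk' hfkC hfkX hx 2 (by decide)
  have h3 := X_mem_of_mem_support k fk hfk' hfkC hfkX hx 3 (by decide)
  refine (Set.ext_iff.mp (range_hypersurfaceι (form k)) x).mpr
    ((ProjectiveSpectrum.mem_zeroLocus _ _ _).mpr (Set.singleton_subset_iff.mpr ?_))
  change form k ∈ x.asHomogeneousIdeal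
  rw [form]
  exact Ideal.sub_mem _ (Ideal.mul_mem_left _ _ (Ideal.pow_mem_of_mem _ h2 2 two_pos))
    (Ideal.mul_mem_left _ _ (Ideal.pow_mem_of_mem _ h3 2 two_pos))

/-- `x₂ ∉ (F)`: evaluate at `(0, 0, 1, 0)`. [folklore] -/
theorem X_two_not_mem_span_form : (X 2 : MvPolynomial (Fin 4) k) ∉ Ideal.span {form k} := by
  intro h
  obtain ⟨q, hq⟩ := Ideal.mem_span_singleton'.mp h
  have h := congrArg (MvPolynomial.eval ![(0 : k), 0, 1, 0]) hq
  rw [form] at h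
  simp at h

include hfkC hfkX in
/-- **`ι(H) ⊄ V(Λ)`**: the generic point `(F)` of `H` lies in `D₊(x₂)`. [folklore] -/
theorem not_range_subset_support :
    ¬ (Set.range (hypersurfaceι (form k)).left ⊆
      ((Proj.map fk hfk').ker.support : Set (Proj (homogeneousSubmodule (Fin (1 + 2 + 1)) k)))) := by
  intro h
  have hmem : (pointOfPrime (form k) (isHomogeneous_form k) (prime_form k) :
      Proj (homogeneousSubmodule (Fin (1 + 2 + 1)) k)) ∈ Set.range (hypersurfaceι (form k)).left := by
    refine (Set.ext_iff.mp (range_hypersurfaceι (form k)) _).mpr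
      ((ProjectiveSpectrum.mem_zeroLocus _ _ _).mpr (Set.singleton_subset_iff.mpr ?_))
    exact Ideal.subset_span rfl
  have h2 := X_mem_of_mem_support k fk hfk' hfkC hfkX (h hmem) 2 (by decide)
  exact X_two_not_mem_span_form k h2

end Kill

/-- Every point of `ℙ³_k` lies in some `D₊(x_c)`. [folklore] -/
theorem exists_mem_basicOpen (x : Proj (homogeneousSubmodule (Fin 4) k)) :
    ∃ c : Fin 4, x ∈ Proj.basicOpen (homogeneousSubmodule (Fin 4) k) (X c) := by
  by_contra! h
  simp only [Proj.mem_basicOpen, not_not] at h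
  refine x.not_irrelevant_le fun a ha => ?_
  exact Ideal.span_le.mpr (Set.range_subset_iff.mpr h) (ProjectiveSpace.irrelevant_le_span 3 k ha)


/-! ## The centre on the chart `Spec (ChartRing F c) → ℙ³_k` -/

section Chart

variable (fk : homogeneousSubmodule (Fin (1 + 2 + 1)) k →+*ᵍ homogeneousSubmodule (Fin (1 + 1)) k)
  (hfk' : HomogeneousIdeal.irrelevant (homogeneousSubmodule (Fin (1 + 1)) k) ≤
    (HomogeneousIdeal.irrelevant (homogeneousSubmodule (Fin (1 + 2 + 1)) k)).map fk) (hfkC : ∀ a : k, fk (C a) = C a)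
  (hfkX : ∀ i : Fin (1 + 2 + 1), fk (X i) = if h : (i : ℕ) < 1 + 1 then X ⟨i, h⟩ else 0)
  (c : Fin 4)

/-- `Spec (ChartRing F c) → H ↪ ℙ³_k` is `Spec (k[x]_{(x_c)} → ChartRing F c)` followed by `D₊(x_c) ↪ ℙ³_k`
(`SmoothHypersurface.chart_hypersurfaceι` on underlying schemes). [folklore] -/
theorem chart_left_comp_ι :
    (chart (form k) c (isHomogeneous_form k) three_pos).left ≫ (hypersurfaceι (form k)).left =
      Spec.map (CommRingCat.ofHom (toChartRing (form k) c (isHomogeneous_form k)).toRingHom) ≫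
        Proj.awayι (homogeneousSubmodule (Fin (2 + 1 + 1)) k) (X c) (X_mem c) one_pos := by
  have h := congrArg (fun f => f.left) (chart_hypersurfaceι (form k) c (isHomogeneous_form k) three_pos)
  simp only [Over.comp_left, specOverOfAlgHom_left, awayChartι_left] at h
  exact h

/-- **Pulling a section `b` of `D₊(x_c)` back to `Spec (ChartRing F c)`** gives `[b]` (through `Γ(Spec A, ⊤) ≅ A`):
`(Spec(toChartRing) ≫ awayι)^* (awayToSection b) = ΓSpecIso⁻¹ (toChartRing b)` (`ProjFrac.appLE_awayι_eq_resAway`,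
`resAway_awayToSection`, naturality of `ΓSpecIso`). [folklore] -/
theorem appLE_chart_awayToSection
    (hle : (⊤ : (Spec (CommRingCat.of (ChartRing (form k) c (isHomogeneous_form k)))).Opens) ≤
      (Spec.map (CommRingCat.ofHom (toChartRing (form k) c (isHomogeneous_form k)).toRingHom) ≫
        Proj.awayι (homogeneousSubmodule (Fin (2 + 1 + 1)) k) (X c) (X_mem c) one_pos) ⁻¹ᵁ
          Proj.basicOpen (homogeneousSubmodule (Fin (2 + 1 + 1)) k) (X c))
    (b : Away (homogeneousSubmodule (Fin (2 + 1 + 1)) k) (X c)) :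
    ((Spec.map (CommRingCat.ofHom (toChartRing (form k) c (isHomogeneous_form k)).toRingHom) ≫
        Proj.awayι (homogeneousSubmodule (Fin (2 + 1 + 1)) k) (X c) (X_mem c) one_pos).appLE
        (Proj.basicOpen (homogeneousSubmodule (Fin (2 + 1 + 1)) k) (X c)) ⊤ hle).hom
        ((Proj.awayToSection (homogeneousSubmodule (Fin (2 + 1 + 1)) k) (X c)).hom b) =
      (Scheme.ΓSpecIso (CommRingCat.of (ChartRing (form k) c (isHomogeneous_form k)))).inv.hom
        (toChartRing (form k) c (isHomogeneous_form k) b) := by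
  have happ : (Spec.map (CommRingCat.ofHom (toChartRing (form k) c (isHomogeneous_form k)).toRingHom) ≫
        Proj.awayι (homogeneousSubmodule (Fin (2 + 1 + 1)) k) (X c) (X_mem c) one_pos).appLE
        (Proj.basicOpen (homogeneousSubmodule (Fin (2 + 1 + 1)) k) (X c)) ⊤ hle =
      (Proj.awayι (homogeneousSubmodule (Fin (2 + 1 + 1)) k) (X c) (X_mem c) one_pos).appLE
          (Proj.basicOpen (homogeneousSubmodule (Fin (2 + 1 + 1)) k) (X c)) ⊤
          (ProjFrac.awayι_preimage_basicOpen_self (X_mem (R := k) c) one_pos).ge ≫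
        (Spec.map (CommRingCat.ofHom (toChartRing (form k) c (isHomogeneous_form k)).toRingHom)).appLE ⊤ ⊤ le_rfl :=
    (Scheme.Hom.appLE_comp_appLE _ _ _ _ _ _ _).symm
  have htop : (Spec.map (CommRingCat.ofHom (toChartRing (form k) c (isHomogeneous_form k)).toRingHom)).appLE ⊤ ⊤ le_rfl =
      (Spec.map (CommRingCat.ofHom (toChartRing (form k) c (isHomogeneous_form k)).toRingHom)).appTop :=
    (Scheme.Hom.app_eq_appLE _).symm
  rw [happ, ProjFrac.appLE_awayι_eq_resAway, htop, CategoryTheory.ConcreteCategory.comp_apply,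
    ProjFrac.resAway_awayToSection]
  have hnat := Scheme.ΓSpecIso_inv_naturality
    (CommRingCat.ofHom (toChartRing (form k) c (isHomogeneous_form k)).toRingHom)
  exact (congrArg (fun f => f.hom b) hnat).symm

/-- The generators `x_{c'}/x_c`, `c' ≥ 2`, of the centre, read in `ChartRing F c`. [folklore] -/
def gen : {c' : Fin (1 + 2 + 1) // 1 + 1 ≤ (c' : ℕ)} → ChartRing (form k) c (isHomogeneous_form k) :=
  fun c' => tautVec (form k) c (isHomogeneous_form k) c'.1

/-- The generators are `x₂/x_c` and `x₃/x_c`. [folklore] -/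
theorem range_gen : Set.range (gen k c) =
    {tautVec (form k) c (isHomogeneous_form k) 2, tautVec (form k) c (isHomogeneous_form k) 3} := by
  ext t
  constructor
  · rintro ⟨⟨c', hc'⟩, rfl⟩
    have h : c' = 2 ∨ c' = 3 := by
      fin_cases c' <;> simp at hc' ⊢
    rcases h with rfl | rfl
    · exact Or.inl rfl
    · exact Or.inr rfl
  · rintro (rfl | rfl)
    · exact ⟨⟨2, by decide⟩, rfl⟩
    · exact ⟨⟨3, by decide⟩, rfl⟩

include hfkC hfkX in
/-- **THE CENTRE ON THE CHART**: the pull-back of `Λ = ker Proj(f_k)` along `Spec (ChartRing F c) → H ↪ ℙ³_k` is the ideal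
sheaf of `(x₂/x_c, x₃/x_c) ⊆ ChartRing F c` (`Limits.ideal_comap_eq_map`, `LinearCentre.ker_projMap_kill_ideal_basicOpen`,
`appLE_chart_awayToSection`). [folklore] -/
theorem comap_chart_eq_ofIdealTop :
    (((Proj.map fk hfk').ker.comap (hypersurfaceι (form k)).left).comap
        (chart (form k) c (isHomogeneous_form k) three_pos).left :
        (Spec (CommRingCat.of (ChartRing (form k) c (isHomogeneous_form k)))).IdealSheafData) =
      ofIdealTop ((Ideal.span (Set.range (gen k c))).map
        (Scheme.ΓSpecIso (CommRingCat.of (ChartRing (form k) c (isHomogeneous_form k)))).inv.hom) := by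
  haveI : IsAffine (Comma.left (specOver k (ChartRing (form k) c (isHomogeneous_form k)))) :=
    inferInstanceAs (IsAffine (Spec (CommRingCat.of (ChartRing (form k) c (isHomogeneous_form k)))))
  set π := Spec.map (CommRingCat.ofHom (toChartRing (form k) c (isHomogeneous_form k)).toRingHom) ≫
    Proj.awayι (homogeneousSubmodule (Fin (2 + 1 + 1)) k) (X c) (X_mem c) one_pos with hπ
  have hcomp : ((Proj.map fk hfk').ker.comap (hypersurfaceι (form k)).left).comap
      (chart (form k) c (isHomogeneous_form k) three_pos).left = (Proj.map fk hfk').ker.comap π := by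
    rw [← Scheme.IdealSheafData.comap_comp]
    exact congrArg (fun f => (Proj.map fk hfk').ker.comap f) (chart_left_comp_ι k c)
  refine hcomp.trans ?_
  let D : (Proj (homogeneousSubmodule (Fin (1 + 2 + 1)) k)).affineOpens :=
    ⟨Proj.basicOpen (homogeneousSubmodule (Fin (1 + 2 + 1)) k) (X c),
      Proj.isAffineOpen_basicOpen _ (X c) (LinearCentre.X_mem_one (r := 1) (m := 2) c) one_pos⟩
  have hV : ((⟨⊤, isAffineOpen_top _⟩ : (Spec (CommRingCat.of (ChartRing (form k) c (isHomogeneous_form k)))).affineOpens) :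
      (Spec (CommRingCat.of (ChartRing (form k) c (isHomogeneous_form k)))).Opens) = π ⁻¹ᵁ (D : (Proj _).Opens) := by
    change ⊤ = Spec.map _ ⁻¹ᵁ (Proj.awayι (homogeneousSubmodule (Fin (2 + 1 + 1)) k) (X c) (X_mem c) one_pos ⁻¹ᵁ
      Proj.basicOpen (homogeneousSubmodule (Fin (2 + 1 + 1)) k) (X c))
    rw [ProjFrac.awayι_preimage_basicOpen_self (X_mem (R := k) c) one_pos]
    rfl
  apply Scheme.IdealSheafData.ext_of_isAffine
  rw [ideal_ofIdealTop_top, Literature.AlgebraicGeometry.Limits.ideal_comap_eq_map π _ D _ hV,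
    LinearCentre.ker_projMap_kill_ideal_basicOpen fk hfk' hfkC hfkX c, Ideal.map_span, Ideal.map_span,
    ← Set.range_comp, ← Set.range_comp]
  refine congrArg Ideal.span (congrArg Set.range (funext fun c' => ?_))
  simp only [Function.comp_apply]
  rw [appLE_chart_awayToSection]
  rfl

/-- **The blow-up chart rings at the generators are regular** (`c = 0, 1`; `…WhitneyCubicForms.isRegularRing_blowupAlgebra_tautVec`
fed by the four strict-transform charts of `…WhitneyCubicAlgebra`). [folklore] -/
theorem isRegularRing_blowupAlgebra_gen (hc : (c : ℕ) < 2) (a : Fin 4) (ha : 2 ≤ (a : ℕ)) :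
    IsRegularRing (blowupAlgebra
      (Ideal.span {tautVec (form k) c (isHomogeneous_form k) 2, tautVec (form k) c (isHomogeneous_form k) 3})
      (tautVec (form k) c (isHomogeneous_form k) a)) := by
  have hc' : c = 0 ∨ c = 1 := by fin_cases c <;> simp at hc ⊢
  have ha' : a = 2 ∨ a = 3 := by fin_cases a <;> simp at ha ⊢
  rcases hc' with rfl | rfl
  · rcases ha' with rfl | rfl
    · exact isRegularRing_blowupAlgebra_tautVec k 0 (f₀ k) (dehomogenize_form_zero k) (radical_span_f₀ k)
        (by decide) (by decide) 0 2 (by decide) (isRegularRing_chart₀₁ k)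
    · exact isRegularRing_blowupAlgebra_tautVec k 0 (f₀ k) (dehomogenize_form_zero k) (radical_span_f₀ k)
        (by decide) (by decide) 1 3 (by decide) (isRegularRing_chart₀₂ k)
  · rcases ha' with rfl | rfl
    · exact isRegularRing_blowupAlgebra_tautVec k 1 (f₁ k) (dehomogenize_form_one k) (radical_span_f₁ k)
        (by decide) (by decide) 0 2 (by decide) (isRegularRing_chart₁₁ k)
    · exact isRegularRing_blowupAlgebra_tautVec k 1 (f₁ k) (dehomogenize_form_one k) (radical_span_f₁ k)
        (by decide) (by decide) 1 3 (by decide) (isRegularRing_chart₁₂ k)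

end Chart

/-- Blow-ups transport along an equality of ideal sheaves (bookkeeping across spellings of the same scheme). [folklore] -/
theorem isBlowup_of_ideal_eq {X' X : Scheme.{0}} {π : X' ⟶ X} {I J : X.IdealSheafData} (h : IsBlowup π I) (e : I = J) :
    IsBlowup π J :=
  e ▸ h

/-! ## Every blow-up of `H` along `Λ · 𝒪_H` is regular -/

section Down

variable (fk : homogeneousSubmodule (Fin (1 + 2 + 1)) k →+*ᵍ homogeneousSubmodule (Fin (1 + 1)) k)
  (hfk' : HomogeneousIdeal.irrelevant (homogeneousSubmodule (Fin (1 + 1)) k) ≤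
    (HomogeneousIdeal.irrelevant (homogeneousSubmodule (Fin (1 + 2 + 1)) k)).map fk) (hfkC : ∀ a : k, fk (C a) = C a)
  (hfkX : ∀ i : Fin (1 + 2 + 1), fk (X i) = if h : (i : ℕ) < 1 + 1 then X ⟨i, h⟩ else 0)

include hfkC hfkX in
/-- **`Bl_Σ H` IS REGULAR, for every blow-up**: every blow-up `ρ : Z → H` of the Whitney-type cubic along the trace
`Λ · 𝒪_H` of the linear centre `Λ = V₊(x₂, x₃)` is a regular scheme. Over `D₊(x_c)` it is a blow-up of
`Spec (ChartRing F c)` along `(x₂/x_c, x₃/x_c)~` (`comap_chart_eq_ofIdealTop`); for `c ≥ 2` that ideal is `(1)` and the blow-up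
is an isomorphism onto the regular `Spec (ChartRing F c)`; for `c ≤ 1` the charts `Spec (ChartRing F c)[I/(x_a/x_c)]` at the
generators (Stacks 0804) are spectra of regular rings. [folklore; Stacks 0804, Liu 8.1.19, GW 13.96] -/
theorem isRegular_of_isBlowup_comap (Z : Scheme.{0}) (ρ : Z ⟶ (hypersurface (form k)).left)
    (hρ : IsBlowup ρ (((Proj.map fk hfk').ker.comap (hypersurfaceι (form k)).left))) : Scheme.IsRegular Z := by
  intro z
  obtain ⟨c, hc⟩ := exists_mem_basicOpen k ((hypersurfaceι (form k)).left (ρ z))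
  let U : (hypersurface (form k)).left.Opens :=
    (hypersurfaceι (form k)).left ⁻¹ᵁ Proj.basicOpen (homogeneousSubmodule (Fin (2 + 1 + 1)) k) (X c)
  have hzU : ρ z ∈ U := hc
  have hrange : Set.range (chart (form k) c (isHomogeneous_form k) three_pos).left = Set.range U.ι := by
    rw [range_chart_left, Scheme.Opens.range_ι]
  let e := IsOpenImmersion.isoOfRangeEq (chart (form k) c (isHomogeneous_form k) three_pos).left U.ι hrange
  have he : e.hom ≫ U.ι = (chart (form k) c (isHomogeneous_form k) three_pos).left :=
    IsOpenImmersion.isoOfRangeEq_hom_fac _ _ _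
  -- the restricted blow-up, moved to `Spec (ChartRing F c)`
  have hρU : IsBlowup ((ρ ∣_ U) ≫ e.symm.hom) (ofIdealTop ((Ideal.span (Set.range (gen k c))).map
      (Scheme.ΓSpecIso (CommRingCat.of (ChartRing (form k) c (isHomogeneous_form k)))).inv.hom)) := by
    have h := (hρ.restrict U).comp_iso e.symm
    rw [← Scheme.IdealSheafData.comap_comp, Iso.symm_inv, he] at h
    exact isBlowup_of_ideal_eq h (comap_chart_eq_ofIdealTop k fk hfk' hfkC hfkX c)
  -- the stalk of `Z` at `z` is the stalk of the open piece `ρ⁻¹ U` at `⟨z, _⟩`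
  haveI : IsIso ((ρ ⁻¹ᵁ U).ι.stalkMap ⟨z, hzU⟩) := inferInstance
  suffices hst : IsRegularLocalRing ((↑(ρ ⁻¹ᵁ U) : Scheme.{0}).presheaf.stalk ⟨z, hzU⟩) from by
    haveI := hst
    exact IsRegularLocalRing.of_ringEquiv (asIso ((ρ ⁻¹ᵁ U).ι.stalkMap ⟨z, hzU⟩)).commRingCatIsoToRingEquiv.symm
  by_cases hc2 : 1 + 1 ≤ (c : ℕ)
  · -- `c = 2, 3`: the centre is the unit ideal, the blow-up is an isomorphism onto the regular `Spec (ChartRing F c)`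
    have htop : Ideal.span (Set.range (gen k c)) = ⊤ :=
      Ideal.eq_top_of_isUnit_mem _ (Ideal.subset_span ⟨⟨c, hc2⟩, rfl⟩)
        (by rw [show gen k c ⟨c, hc2⟩ = tautVec (form k) c (isHomogeneous_form k) c from rfl, tautVec_self]
            exact isUnit_one)
    have hI : ofIdealTop ((Ideal.span (Set.range (gen k c))).map
        (Scheme.ΓSpecIso (CommRingCat.of (ChartRing (form k) c (isHomogeneous_form k)))).inv.hom) = ⊤ := by
      rw [htop, Ideal.map_top]
      exact Scheme.IdealSheafData.ext_of_isAffine (by rw [ideal_ofIdealTop_top]; rfl)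
    have hρU' : IsBlowup ((ρ ∣_ U) ≫ e.symm.hom)
        (⊤ : (Spec (CommRingCat.of (ChartRing (form k) c (isHomogeneous_form k)))).IdealSheafData) := by
      rw [← hI]
      exact hρU
    haveI : IsIso ((ρ ∣_ U) ≫ e.symm.hom) := hρU'.isIso isEffectiveCartier_top
    haveI : IsRegularRing (ChartRing (form k) c (isHomogeneous_form k)) := isRegularRing_chartRing_of_two_le k c hc2
    haveI : IsRegularLocalRing ((Spec (CommRingCat.of (ChartRing (form k) c (isHomogeneous_form k)))).presheaf.stalk
        (((ρ ∣_ U) ≫ e.symm.hom) ⟨z, hzU⟩)) :=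
      Scheme.isRegular_Spec (CommRingCat.of (ChartRing (form k) c (isHomogeneous_form k))) (((ρ ∣_ U) ≫ e.symm.hom) ⟨z, hzU⟩)
    exact IsRegularLocalRing.of_ringEquiv
      (R := (Spec (CommRingCat.of (ChartRing (form k) c (isHomogeneous_form k)))).presheaf.stalk (((ρ ∣_ U) ≫ e.symm.hom) ⟨z, hzU⟩))
      (asIso (((ρ ∣_ U) ≫ e.symm.hom).stalkMap ⟨z, hzU⟩)).commRingCatIsoToRingEquiv
  · -- `c = 0, 1`: the charts at the generators are spectra of regular rings
    have hc' : (c : ℕ) < 2 := by omega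
    obtain ⟨j, φ, hφ, hzφ, -⟩ := IsBlowup.exists_chart_of_span_range_eq hρU (gen k c) rfl ⟨z, hzU⟩
    obtain ⟨w, hw⟩ := hzφ
    have hreg : IsRegularRing (blowupAlgebra (Ideal.span (Set.range (gen k c))) (gen k c j)) := by
      rw [range_gen]
      exact isRegularRing_blowupAlgebra_gen k c hc' j.1 j.2
    haveI := hreg
    by_contra hz
    rw [← hw] at hz
    exact not_isRegularLocalRing_localization_of_stalk φ w hz inferInstance

end Down


/-! ## EL♮ for the Whitney-type cubic -/

/-- **EL♮ HOLDS FOR THE WHITNEY-TYPE CUBIC `H = V₊(x₁x₂² − x₀x₃²) ⊂ ℙ³_k`** (`k` algebraically closed of characteristic `p`, any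
`p`): `Theorems.EquisingularLift.ELNatAt p k 3 H ι` (p503491) — the `∃ (O, π, P′, σ, S′)` body of the item `EquisingularLiftNat`
at this `H`. Witnesses: `O = 𝕎(k)` (`stub_wittRing`), ONE blow-up of `ℙ³_O` along the `O`-line `C = V(x₂, x₃) = ker Proj(f_O)`
(regular `≅ ℙ¹_O`, `O`-flat; `C · 𝒪_{ℙ³_k} = Λ = ker Proj(f_k)` by `LinearCentre.comap_ker_projMap_kill`); E1 since
`V(Λ) ⊆ V₊(F)`; off the generic point since `(F) ∉ V(Λ)`; and DOWNSTAIRS every blow-up of `H` along `Λ · 𝒪_H` is regular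
(`isRegular_of_isBlowup_comap`). Assembled by `elNatAt_of_oneStep₀` (p505461). [OURS · L1 W4.5b] [folklore] -/
theorem elNatAt_whitneyCubic (p : ℕ) (hp : p.Prime) (K : Type) [Field K] [CharP K p] [IsAlgClosed K] :
    Theorems.EquisingularLift.ELNatAt p K 3 (hypersurface (form K)).left (hypersurfaceι (form K)).left := by
  classical
  obtain ⟨O, i1, i2, i3, i4, -, -, π, hπ⟩ := stub_wittRing p hp K
  obtain ⟨fO, hfO', hfOC, hfOX⟩ := LinearCentre.exists_kill O 1 2
  obtain ⟨fk, hfk', hfkC, hfkX⟩ := LinearCentre.exists_kill K 1 2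
  haveI := isIntegral_hypersurface K
  -- the centre `C = ker Proj(f_O)`: regular (`≅ ℙ¹_O`) and `O`-flat — as in `LinearCentre.EL_of_linearCentre`
  obtain ⟨hsmr, -⟩ := stub_projectiveAmbientSmoothProper O 1
  set iO : Proj (homogeneousSubmodule (Fin (1 + 1)) O) ⟶ Proj (homogeneousSubmodule (Fin (1 + 2 + 1)) O) :=
    Proj.map fO hfO' with hiOdef
  haveI : IsClosedImmersion iO :=
    Literature.AlgebraicGeometry.FundamentalGroup.isClosedImmersion_projMap_of_surjective fO hfO'
      (LinearCentre.kill_surjective fO.toRingHom (fun a => hfOC a) (fun i => hfOX i))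
  have hRr : Scheme.IsRegular (Proj (homogeneousSubmodule (Fin (1 + 1)) O)) := fun y =>
    (stub_goodAtOfSmooth O _ _ hsmr y).1
  have hCreg : Scheme.IsRegular iO.ker.subscheme := hRr.of_iso iO.toImage
  have hCflat : Flat (iO.ker.subschemeι ≫ Proj.toSpecZero (homogeneousSubmodule (Fin (1 + 2 + 1)) O) ≫
      Spec.map (CommRingCat.ofHom (algebraMap O (homogeneousSubmodule (Fin (1 + 2 + 1)) O 0)))) := by
    have h1 : iO.toImage ≫ iO.ker.subschemeι ≫ (Proj.toSpecZero (homogeneousSubmodule (Fin (1 + 2 + 1)) O) ≫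
        Spec.map (CommRingCat.ofHom (algebraMap O (homogeneousSubmodule (Fin (1 + 2 + 1)) O 0)))) =
        Proj.toSpecZero (homogeneousSubmodule (Fin (1 + 1)) O) ≫
          Spec.map (CommRingCat.ofHom (algebraMap O (homogeneousSubmodule (Fin (1 + 1)) O 0))) := by
      rw [← Category.assoc]
      change (iO.toImage ≫ iO.imageι) ≫ _ = _
      rw [Scheme.Hom.toImage_imageι]
      exact LinearCentre.projMap_kill_comp_structureMap fO hfO' hfOC hfOX
    haveI := hsmr
    have h2 : Flat (iO.toImage ≫ iO.ker.subschemeι ≫ (Proj.toSpecZero (homogeneousSubmodule (Fin (1 + 2 + 1)) O) ≫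
        Spec.map (CommRingCat.ofHom (algebraMap O (homogeneousSubmodule (Fin (1 + 2 + 1)) O 0))))) := by
      rw [h1]; infer_instance
    exact (MorphismProperty.cancel_left_of_respectsIso @Flat iO.toImage _).mp h2
  -- `n` is spelled `1 + 2` so that `Fin (n + 1)` is literally the kill maps' `Fin (1 + 2 + 1)` (cheap unification)
  refine elNatAt_of_oneStep₀ K (1 + 2) _ (hypersurfaceι (form K)).left O π hπ iO.ker hCreg hCflat (Proj.map fk hfk').ker
    ?_ ?_ ?_ ?_
  · intro φ hφ' hφ
    exact LinearCentre.comap_ker_projMap_kill π hπ φ hφ hφ' fO hfO' hfOC hfOX fk hfk' hfkC hfkX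
  · exact not_range_subset_support K fk hfk' hfkC hfkX
  · exact support_subset_range K fk hfk' hfkC hfkX
  · intro Z ρ hρ
    exact isRegular_of_isBlowup_comap K fk hfk' hfkC hfkX Z ρ hρ

end WhitneyCubic

end Summit.ResolutionOfSingularities.ResolutionOfSingularities.Cruxes.EquisingularLiftNat.Sections

end
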